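import Mathlib
import Summits.Ventures.PercRepro2.Defs
import Summits.Ventures.PercRepro2.Independence
import Summits.Ventures.PercRepro2.Harris
import Summits.Ventures.PercRepro2.ObsIndependence
import Summits.Ventures.PercRepro2.CoinDefs
import Summits.Ventures.PercRepro2.CoinSinkAlg
import Summits.Ventures.PercRepro2.CoinArcsOff
import Summits.Ventures.PercRepro2.CoinPendantDefs

/-!
# The PENDANT OUT-STRUCTURE case of row 2′DARC (blind cell PercRepro2, night-2;
proofs/NIGHT2-DARC.md §11) — the sink theorem with the whole forward closure of `w` pendant

With the hypotheses of `CoinPendantDefs.lean` and `s, a, b ∉ Z′ ∪ T`: `{w ∈ K⁻}` depends only on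
the pendant coins, the gate event is `(Gᶜ ∩ R_T) ∪ (G ∩ R_{T∪{u,w}})` and `R_T = (Gᶜ ∩ R_T) ∪
(G ∩ R_{T∪{w}})` with every event and marker inside the branches those of `D₀ = arcsOff arcs (Z′ ∪ T)`;
the masses factorise across the pendant coins (`expect_mul_eq_mul_of_dependsOn`) and the two-branch
sign lemma `sink_alg` gives `DARC` from four directed-BHK facts on `D₀` (`darc_of_pendant`,
CONDITIONAL on directed BHK for mixed coin systems).  The sink case (`CoinSink.lean`) is `Z′ = {w}`;
pendant paths `w → v₁ → ⋯ → T`, pendant out-trees and out-DAGs at `w` are covered.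
-/

namespace Summit.Ventures.PercRepro2.Coin

/-! ## The conditional theorem -/

section Theorem

open Classical

variable {V : Type*} {E : Type*} [DecidableEq V] [Fintype E] [DecidableEq E]
  {R : Type*} [Field R] [LinearOrder R] [IsStrictOrderedRing R]

omit [Fintype E] [DecidableEq E] in
/-- `{w ∈ K⁻}` depends only on the pendant coins. -/
lemma dependsOn_bwdEvent_pendant (arcs : E → Finset (V × V)) {Z' T : Finset V}
    (hclosed : ClosedOut arcs Z' T) {w : V} (hw : w ∈ Z') :
    DependsOn (· ∈ bwdEvent arcs w T) (tailCoins arcs Z') := by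
  intro ω ω' h
  simp only [eq_iff_iff]
  rw [bwdEvent_iff_arcsOn hclosed hw ω, bwdEvent_iff_arcsOn hclosed hw ω']
  constructor
  · rintro ⟨t, ht, hr⟩; exact ⟨t, ht, (reach_arcsOn_congr h).mp hr⟩
  · rintro ⟨t, ht, hr⟩; exact ⟨t, ht, (reach_arcsOn_congr h).mpr hr⟩

omit [LinearOrder R] [IsStrictOrderedRing R] in
/-- Product rule for a branch (as in `CoinSink.lean`). -/
lemma massE_inter_of_dependsOn' (p : E → R) (F : Set E) (C : Set (Config E))
    (hC : DependsOn (· ∈ C) F) (g : Config E → R) (D : Set (Config E))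
    (hgD : DependsOn (D.indicator g) Fᶜ) :
    massE p g (C ∩ D) = prob p C * massE p g D := by
  unfold massE
  have h1 : (C ∩ D).indicator g = C.indicator (1 : Config E → R) * D.indicator g := by
    ext ω
    by_cases hC' : ω ∈ C <;> by_cases hD' : ω ∈ D <;> simp [Set.indicator, hC', hD']
  rw [h1, prob_eq_expect_indicator]
  exact expect_mul_eq_mul_of_dependsOn p (F₁ := F) (F₂ := Fᶜ) disjoint_compl_right
    (dependsOn_indicator hC) hgD

omit [LinearOrder R] [IsStrictOrderedRing R] in
/-- `massE` only sees the values of the integrand on the event. -/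
lemma massE_congr' (p : E → R) {f g : Config E → R} {D : Set (Config E)}
    (h : ∀ ω ∈ D, f ω = g ω) : massE p f D = massE p g D := by
  unfold massE
  congr 1
  exact Set.indicator_congr h

/-- **THEOREM (the pendant out-structure case of row 2′DARC), conditional on directed BHK for the
reduced mixed system.** With `Z′ ∋ w` closed out into `T`, entered only at `w`, its pendant coins
mixed, and `s, a, b ∉ Z′ ∪ T`: from the positivity of the three reduced avoidance events
`R₁ = R^{D₀}_T ⊇ R₂ = R^{D₀}_{T∪{w}} ⊇ R₃ = R^{D₀}_{T∪{u,w}}` (`D₀ = arcsOff arcs (Z′ ∪ T)`), the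
nonnegativity of the conditional covariances on `R₁`, `R₃` and the decrease of the conditional means
along the chain (cleared forms), the gate functional of the arc `u → w` is nonnegative. -/
theorem darc_of_pendant (p : E → R) (hp : IsProbVec p) (arcs : E → Finset (V × V)) (s : V)
    (T : Finset V) (a b u w : V) (Z' : Finset V) (hw : w ∈ Z') (hs : s ∉ Z')
    (ha : a ∉ Z' ∪ T) (hb : b ∉ Z' ∪ T) (hclosed : ClosedOut arcs Z' T)
    (hentry : EntryOnly arcs Z' w) (hT : TailCoinsIn arcs Z' T)
    (hP₁ : 0 < prob p (avoidEvent (arcsOff arcs (Z' ∪ T)) s T))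
    (hP₂ : 0 < prob p (avoidEvent (arcsOff arcs (Z' ∪ T)) s (insert w T)))
    (hP₃ : 0 < prob p (avoidEvent (arcsOff arcs (Z' ∪ T)) s (insert u (insert w T))))
    (hcov₁ : 0 ≤ covC p (arcsOff arcs (Z' ∪ T)) s a b (avoidEvent (arcsOff arcs (Z' ∪ T)) s T))
    (hcov₃ : 0 ≤ covC p (arcsOff arcs (Z' ∪ T)) s a b
      (avoidEvent (arcsOff arcs (Z' ∪ T)) s (insert u (insert w T))))
    (hA₁₂ : massE p (marker (R := R) (arcsOff arcs (Z' ∪ T)) s a)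
        (avoidEvent (arcsOff arcs (Z' ∪ T)) s (insert w T))
        * prob p (avoidEvent (arcsOff arcs (Z' ∪ T)) s T) ≤
      massE p (marker (R := R) (arcsOff arcs (Z' ∪ T)) s a)
        (avoidEvent (arcsOff arcs (Z' ∪ T)) s T)
        * prob p (avoidEvent (arcsOff arcs (Z' ∪ T)) s (insert w T)))
    (hA₂₃ : massE p (marker (R := R) (arcsOff arcs (Z' ∪ T)) s a)
        (avoidEvent (arcsOff arcs (Z' ∪ T)) s (insert u (insert w T)))
        * prob p (avoidEvent (arcsOff arcs (Z' ∪ T)) s (insert w T)) ≤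
      massE p (marker (R := R) (arcsOff arcs (Z' ∪ T)) s a)
        (avoidEvent (arcsOff arcs (Z' ∪ T)) s (insert w T))
        * prob p (avoidEvent (arcsOff arcs (Z' ∪ T)) s (insert u (insert w T))))
    (hB₁₂ : massE p (marker (R := R) (arcsOff arcs (Z' ∪ T)) s b)
        (avoidEvent (arcsOff arcs (Z' ∪ T)) s (insert w T))
        * prob p (avoidEvent (arcsOff arcs (Z' ∪ T)) s T) ≤
      massE p (marker (R := R) (arcsOff arcs (Z' ∪ T)) s b)
        (avoidEvent (arcsOff arcs (Z' ∪ T)) s T)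
        * prob p (avoidEvent (arcsOff arcs (Z' ∪ T)) s (insert w T)))
    (hB₂₃ : massE p (marker (R := R) (arcsOff arcs (Z' ∪ T)) s b)
        (avoidEvent (arcsOff arcs (Z' ∪ T)) s (insert u (insert w T)))
        * prob p (avoidEvent (arcsOff arcs (Z' ∪ T)) s (insert w T)) ≤
      massE p (marker (R := R) (arcsOff arcs (Z' ∪ T)) s b)
        (avoidEvent (arcsOff arcs (Z' ∪ T)) s (insert w T))
        * prob p (avoidEvent (arcsOff arcs (Z' ∪ T)) s (insert u (insert w T)))) :
    DARC p arcs s T a b u w := by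
  set Z : Finset V := Z' ∪ T with hZ
  set D₀ := arcsOff arcs Z with hD₀
  set F := tailCoins arcs Z' with hF
  set G := bwdEvent arcs w T with hG
  set X := marker (R := R) arcs s a with hX
  set Y := marker (R := R) arcs s b with hY
  set X₀ := marker (R := R) D₀ s a with hX₀
  set Y₀ := marker (R := R) D₀ s b with hY₀
  set R₁ := avoidEvent D₀ s T with hR₁
  set R₂ := avoidEvent D₀ s (insert w T) with hR₂
  set R₃ := avoidEvent D₀ s (insert u (insert w T)) with hR₃
  have hw₂ : w ∈ insert w T := Finset.mem_insert_self w T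
  have hT₂ : T ⊆ insert w T := Finset.subset_insert w T
  have hw₃ : w ∈ insert u (insert w T) := Finset.mem_insert_of_mem hw₂
  have hT₃ : T ⊆ insert u (insert w T) := hT₂.trans (Finset.subset_insert u _)
  -- the event identities
  have hRT : avoidEvent arcs s T = (Gᶜ ∩ R₁) ∪ (G ∩ R₂) := by
    rw [avoidEvent_bwd_decomp arcs s T w, Set.inter_comm Gᶜ, avoid_inter_compl_bwd hentry hs,
      Set.inter_comm _ Gᶜ, avoidEvent_pendant hentry hs hw₂ hT₂]
  have hGate : gateEvent arcs s T u w = (Gᶜ ∩ R₁) ∪ (G ∩ R₃) := by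
    rw [gateEvent_bwd_decomp arcs s T u w, Set.inter_comm Gᶜ, avoid_inter_compl_bwd hentry hs,
      Set.inter_comm _ Gᶜ, avoidEvent_pendant hentry hs hw₃ hT₃]
  have hdisj₂ : Disjoint (Gᶜ ∩ R₁) (G ∩ R₂) :=
    Set.disjoint_left.2 fun ω h₁ h₂ => h₁.1 h₂.1
  have hdisj₃ : Disjoint (Gᶜ ∩ R₁) (G ∩ R₃) :=
    Set.disjoint_left.2 fun ω h₁ h₂ => h₁.1 h₂.1
  -- dependence structure
  have hGF : DependsOn (· ∈ G) F := dependsOn_bwdEvent_pendant arcs hclosed hw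
  have hGcF : DependsOn (· ∈ Gᶜ) F := dependsOn_compl hGF
  have hcongr : ∀ ω ω' : Config E, (∀ e ∈ Fᶜ, ω e = ω' e) → ∀ e, D₀ e ≠ ∅ → ω e = ω' e := by
    intro ω ω' h e he
    by_cases hmem : e ∈ F
    · exact absurd (arcsOff_eq_empty_of_tailCoins hT hmem) he
    · exact h e hmem
  have hdep : ∀ (X' : Finset V) (f : Config E → R), DependsOn f Fᶜ →
      DependsOn ((avoidEvent D₀ s X').indicator f) Fᶜ := by
    intro X' f hf ω ω' h
    have hreach : ∀ x y, Reach D₀ ω x y ↔ Reach D₀ ω' x y :=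
      fun x y => reach_arcsOff_congr (hcongr ω ω' h)
    have hmem : ω ∈ avoidEvent D₀ s X' ↔ ω' ∈ avoidEvent D₀ s X' := by
      simp only [avoidEvent, Set.mem_setOf_eq, hreach]
    by_cases hω : ω ∈ avoidEvent D₀ s X'
    · rw [Set.indicator_of_mem hω, Set.indicator_of_mem (hmem.mp hω)]; exact hf h
    · rw [Set.indicator_of_notMem hω, Set.indicator_of_notMem (fun h' => hω (hmem.mpr h'))]
  have hdepX : DependsOn X₀ Fᶜ := by
    intro ω ω' h
    have hr : Reach D₀ ω s a ↔ Reach D₀ ω' s a := reach_arcsOff_congr (hcongr ω ω' h)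
    simp only [hX₀, marker, hr]
  have hdepY : DependsOn Y₀ Fᶜ := by
    intro ω ω' h
    have hr : Reach D₀ ω s b ↔ Reach D₀ ω' s b := reach_arcsOff_congr (hcongr ω ω' h)
    simp only [hY₀, marker, hr]
  have hdepXY : DependsOn (fun ω => X₀ ω * Y₀ ω) Fᶜ := fun ω ω' h => by
    show X₀ ω * Y₀ ω = X₀ ω' * Y₀ ω'
    rw [hdepX h, hdepY h]
  have hdep1 : DependsOn (fun _ : Config E => (1 : R)) Fᶜ := fun _ _ _ => rfl
  have hfac : ∀ (B₀ : Set (Config E)) (hB₀ : DependsOn (· ∈ B₀) F) (X' : Finset V)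
      (f : Config E → R) (hf : DependsOn f Fᶜ),
      massE p f (B₀ ∩ avoidEvent D₀ s X') = prob p B₀ * massE p f (avoidEvent D₀ s X') :=
    fun B₀ hB₀ X' f hf => massE_inter_of_dependsOn' p F B₀ hB₀ f _ (hdep X' f hf)
  -- the markers on the four pieces
  have hmX₁ : ∀ ω ∈ Gᶜ ∩ R₁, X ω = X₀ ω := by
    rintro ω ⟨hω, hω'⟩
    have hR : ω ∈ avoidEvent arcs s T := by
      rw [hRT]; exact Or.inl ⟨hω, hω'⟩
    have hr : Reach arcs ω s a ↔ Reach D₀ ω s a := reach_iff_compl_bwd hclosed hentry hw hs hR hω ha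
    simp only [hX, hX₀, marker, hr]
  have hmY₁ : ∀ ω ∈ Gᶜ ∩ R₁, Y ω = Y₀ ω := by
    rintro ω ⟨hω, hω'⟩
    have hR : ω ∈ avoidEvent arcs s T := by
      rw [hRT]; exact Or.inl ⟨hω, hω'⟩
    have hr : Reach arcs ω s b ↔ Reach D₀ ω s b := reach_iff_compl_bwd hclosed hentry hw hs hR hω hb
    simp only [hY, hY₀, marker, hr]
  have hmX₂ : ∀ ω ∈ G ∩ R₂, X ω = X₀ ω := by
    rintro ω ⟨_, hω'⟩
    have hR : ω ∈ avoidEvent arcs s (insert w T) := by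
      rw [avoidEvent_pendant hentry hs hw₂ hT₂]; exact hω'
    have hr : Reach arcs ω s a ↔ Reach D₀ ω s a := reach_iff_pendant hentry hs hw₂ hT₂ hR a
    simp only [hX, hX₀, marker, hr]
  have hmY₂ : ∀ ω ∈ G ∩ R₂, Y ω = Y₀ ω := by
    rintro ω ⟨_, hω'⟩
    have hR : ω ∈ avoidEvent arcs s (insert w T) := by
      rw [avoidEvent_pendant hentry hs hw₂ hT₂]; exact hω'
    have hr : Reach arcs ω s b ↔ Reach D₀ ω s b := reach_iff_pendant hentry hs hw₂ hT₂ hR b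
    simp only [hY, hY₀, marker, hr]
  have hmX₃ : ∀ ω ∈ G ∩ R₃, X ω = X₀ ω := by
    rintro ω ⟨_, hω'⟩
    have hR : ω ∈ avoidEvent arcs s (insert u (insert w T)) := by
      rw [avoidEvent_pendant hentry hs hw₃ hT₃]; exact hω'
    have hr : Reach arcs ω s a ↔ Reach D₀ ω s a := reach_iff_pendant hentry hs hw₃ hT₃ hR a
    simp only [hX, hX₀, marker, hr]
  have hmY₃ : ∀ ω ∈ G ∩ R₃, Y ω = Y₀ ω := by
    rintro ω ⟨_, hω'⟩
    have hR : ω ∈ avoidEvent arcs s (insert u (insert w T)) := by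
      rw [avoidEvent_pendant hentry hs hw₃ hT₃]; exact hω'
    have hr : Reach arcs ω s b ↔ Reach D₀ ω s b := reach_iff_pendant hentry hs hw₃ hT₃ hR b
    simp only [hY, hY₀, marker, hr]
  have hmXY₁ : ∀ ω ∈ Gᶜ ∩ R₁, X ω * Y ω = X₀ ω * Y₀ ω := fun ω hω => by
    rw [hmX₁ ω hω, hmY₁ ω hω]
  have hmXY₃ : ∀ ω ∈ G ∩ R₃, X ω * Y ω = X₀ ω * Y₀ ω := fun ω hω => by
    rw [hmX₃ ω hω, hmY₃ ω hω]
  -- the eight masses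
  set c := prob p Gᶜ with hc
  set c' := prob p G with hc'
  set P₁ := prob p R₁ with hP₁'
  set P₂ := prob p R₂ with hP₂'
  set P₃ := prob p R₃ with hP₃'
  set A₁ := massE p X₀ R₁ with hA₁
  set A₂ := massE p X₀ R₂ with hA₂
  set A₃ := massE p X₀ R₃ with hA₃
  set B₁ := massE p Y₀ R₁ with hB₁
  set B₂ := massE p Y₀ R₂ with hB₂
  set B₃ := massE p Y₀ R₃ with hB₃
  set C₁ := massE p (fun ω => X₀ ω * Y₀ ω) R₁ with hC₁
  set C₃ := massE p (fun ω => X₀ ω * Y₀ ω) R₃ with hC₃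
  have eP : prob p (avoidEvent arcs s T) = c * P₁ + c' * P₂ := by
    rw [hRT, prob_union_of_disjoint p hdisj₂, prob_eq_massE_one, prob_eq_massE_one,
      hfac Gᶜ hGcF T _ hdep1, hfac G hGF (insert w T) _ hdep1, ← prob_eq_massE_one,
      ← prob_eq_massE_one]
  have eA : massE p X (avoidEvent arcs s T) = c * A₁ + c' * A₂ := by
    rw [hRT, massE_union_of_disjoint p X hdisj₂, massE_congr' p hmX₁, massE_congr' p hmX₂,
      hfac Gᶜ hGcF T X₀ hdepX, hfac G hGF (insert w T) X₀ hdepX]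
  have eB : massE p Y (avoidEvent arcs s T) = c * B₁ + c' * B₂ := by
    rw [hRT, massE_union_of_disjoint p Y hdisj₂, massE_congr' p hmY₁, massE_congr' p hmY₂,
      hfac Gᶜ hGcF T Y₀ hdepY, hfac G hGF (insert w T) Y₀ hdepY]
  have ePG : prob p (gateEvent arcs s T u w) = c * P₁ + c' * P₃ := by
    rw [hGate, prob_union_of_disjoint p hdisj₃, prob_eq_massE_one, prob_eq_massE_one,
      hfac Gᶜ hGcF T _ hdep1, hfac G hGF (insert u (insert w T)) _ hdep1, ← prob_eq_massE_one,
      ← prob_eq_massE_one]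
  have eAG : massE p X (gateEvent arcs s T u w) = c * A₁ + c' * A₃ := by
    rw [hGate, massE_union_of_disjoint p X hdisj₃, massE_congr' p hmX₁, massE_congr' p hmX₃,
      hfac Gᶜ hGcF T X₀ hdepX, hfac G hGF (insert u (insert w T)) X₀ hdepX]
  have eBG : massE p Y (gateEvent arcs s T u w) = c * B₁ + c' * B₃ := by
    rw [hGate, massE_union_of_disjoint p Y hdisj₃, massE_congr' p hmY₁, massE_congr' p hmY₃,
      hfac Gᶜ hGcF T Y₀ hdepY, hfac G hGF (insert u (insert w T)) Y₀ hdepY]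
  have eCG : massE p (fun ω => X ω * Y ω) (gateEvent arcs s T u w) = c * C₁ + c' * C₃ := by
    rw [hGate, massE_union_of_disjoint p _ hdisj₃, massE_congr' p hmXY₁, massE_congr' p hmXY₃,
      hfac Gᶜ hGcF T _ hdepXY, hfac G hGF (insert u (insert w T)) _ hdepXY]
  -- assemble
  unfold DARC phiC
  simp only []
  rw [eP, eA, eB, ePG, eAG, eBG, eCG]
  have hc0 : 0 ≤ c := prob_nonneg hp _
  have hc0' : 0 ≤ c' := prob_nonneg hp _
  have hcov₁' : A₁ * B₁ ≤ P₁ * C₁ := by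
    have := hcov₁
    simp only [covC] at this
    linarith
  have hcov₃' : A₃ * B₃ ≤ P₃ * C₃ := by
    have := hcov₃
    simp only [covC] at this
    linarith
  exact sink_alg hP₁ hP₂ hP₃ hc0 hc0' hcov₁' hcov₃' hA₁₂ hA₂₃ hB₁₂ hB₂₃

end Theorem

end Summit.Ventures.PercRepro2.Coin
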